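import Literature.Combinatorics.Enumerative.PermanentLaplaceExpansion
import Literature.Computability.AlgebraicComplexity.StandardFamilies

/-!
# Line `laplace_rigidity`: the Laplace expansion along `k` rows IS a `(k, n-k)` two-factor
# decomposition of `per_n` of width `C(n,k)` — the conjectured extremiser exists

The law `LaplaceRigidity` of line `laplace_rigidity` (crux `CoverDecancellation`,
stmt-ValiantsHypothesis-17819; `Cruxes/CoverDecancellation/Lines/laplace_rigidity.lean`) asserts the
LOWER bound `C(n,k) ≤ w` for every decomposition `per_n = Σ_{i<w} p_i q_i` with `deg p_i = k`,
`deg q_i = n - k`, i.e. `str_k(per_n) ≥ C(n,k)` (Gesmundo–Ghosal–Ikenmeyer–Lysikov 2022, Def. 10).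
This file PROVES the matching UPPER bound `str_k(per_n) ≤ C(n,k)` for all `k ≤ n`: the generalised
Laplace expansion of the permanent along the first `k` rows (Minc, *Permanents*, Ch. 2 Thm. 1.2;
tree: `Literature.Combinatorics.Enumerative.permanent_eq_sum_powersetCard_mul`) is a `(k, n-k)` two-factor decomposition of
width exactly `C(n,k)`, in the line's vocabulary (`IsTwoFactorDecomp n k (n.choose k) p q`
unfolded):

* `laplace_twoFactorDecomp` — `∃ p q : Fin (n.choose k) → ℂ[X_{n×n}]`, `p i` homogeneous of
  degree `k`, `q i` homogeneous of degree `n - k`, `per_n = Σ_i p_i q_i`.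

So the law, if true, is sharp, and its conjectured extremiser is a kernel object.  Honest framing:
this is the trivial half of `str_k(per_n) = C(n,k)`; it holds verbatim for `det_n` (with signs) and
is NOT evidence for the law; no rung moves, `CoverDecancellation` stays HELD, VP ≠ VNP is NOT
proved.  Helper for stmt-ValiantsHypothesis-17819 (`--supports`).  val-width-17819-w1 g0, 2026-08-28.

## References
* H. Minc, *Permanents*, Encyclopedia Math. Appl. 6 (1978), Ch. 2, Thm. 1.2 (Laplace expansion).
  [Minc1978]
* F. Gesmundo, P. Ghosal, C. Ikenmeyer, V. Lysikov, *Degree-restricted strength decompositions and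
  algebraic branching programs*, arXiv:2205.02149, Def. 10. [GGIL22]
-/

set_option linter.dupNamespace false

noncomputable section

namespace Summit.ValiantsHypothesis.ValiantsHypothesis.Theorems.PolyaContinuedLaplaceRigidity.Laplace

open MvPolynomial Matrix Finset
open Literature.Computability.AlgebraicComplexity

/-- A bijection sum `Σ_{b : P ≃ J} ∏_{p ∈ P} X_{p, b p}` of the generic matrix is homogeneous of
degree `|P|`. [folklore] -/
theorem isHomogeneous_sum_equiv_prod {n : ℕ} (P J : Finset (Fin n)) :
    (∑ b : ↥P ≃ ↥J, ∏ p : ↥P,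
      (mvPolynomialX (Fin n) (Fin n) ℂ) p (b p)).IsHomogeneous P.card := by
  classical
  refine IsHomogeneous.sum _ _ _ fun b _ => ?_
  have h := IsHomogeneous.prod (φ := fun p : ↥P => (mvPolynomialX (Fin n) (Fin n) ℂ) p (b p))
    (n := fun _ => 1) Finset.univ (fun p _ => by
      rw [mvPolynomialX_apply]; exact isHomogeneous_X ℂ _)
  simpa [Finset.card_univ] using h

/-- **The Laplace expansion along the first `k` rows is a `(k, n-k)` two-factor decomposition of
`per_n` of width `C(n,k)`** (`k ≤ n`): there are `p_i` homogeneous of degree `k` and `q_i`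
homogeneous of degree `n - k`, `i < C(n,k)`, with `per_n = Σ_i p_i q_i` — the minors
`per X[P, J]` and `per X[Pᶜ, Jᶜ]` for `P = {0, …, k-1}` and `J` running over the `k`-subsets of
the columns.  Hence `str_k(per_n) ≤ C(n,k)`: the law `LaplaceRigidity` (`C(n,k) ≤ w`) is sharp if
true. [cite: Minc1978, Ch. 2, Thm. 1.2] -/
theorem laplace_twoFactorDecomp (n k : ℕ) (hk : k ≤ n) :
    ∃ p q : Fin (n.choose k) → MvPolynomial (Fin n × Fin n) ℂ,
      (∀ i, (p i).IsHomogeneous k) ∧ (∀ i, (q i).IsHomogeneous (n - k)) ∧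
        perPoly (Fin n) ℂ = ∑ i, p i * q i := by
  classical
  -- the first `k` rows
  set P : Finset (Fin n) := Finset.univ.image (Fin.castLE hk) with hP
  have hPcard : P.card = k := by
    rw [hP, Finset.card_image_of_injective _ (Fin.castLE_injective hk), Finset.card_univ,
      Fintype.card_fin]
  have hPccard : Pᶜ.card = n - k := by
    rw [Finset.card_compl, hPcard, Fintype.card_fin]
  -- the `k`-subsets of the columns, enumerated by `Fin (n.choose k)`
  set S : Finset (Finset (Fin n)) := (Finset.univ : Finset (Fin n)).powersetCard k with hS
  have hScard : S.card = n.choose k := by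
    rw [hS, Finset.card_powersetCard, Finset.card_univ, Fintype.card_fin]
  let e : Fin (n.choose k) ≃ ↥S := (S.equivFinOfCardEq hScard).symm
  set A := mvPolynomialX (Fin n) (Fin n) ℂ with hA
  refine ⟨fun i => ∑ b : ↥P ≃ ↥((e i : Finset (Fin n))), ∏ p : ↥P, A p (b p),
    fun i => ∑ b' : ↥(Pᶜ) ≃ ↥(((e i : Finset (Fin n)))ᶜ), ∏ p : ↥(Pᶜ), A p (b' p),
    fun i => ?_, fun i => ?_, ?_⟩
  · have h := isHomogeneous_sum_equiv_prod P (e i : Finset (Fin n))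
    rw [hPcard] at h
    simpa only [hA] using h
  · have h := isHomogeneous_sum_equiv_prod Pᶜ ((e i : Finset (Fin n)))ᶜ
    rw [hPccard] at h
    simpa only [hA] using h
  · -- Laplace expansion along `P`, re-indexed along `e`
    have hL := Literature.Combinatorics.Enumerative.permanent_eq_sum_powersetCard_mul A P
    rw [hPcard] at hL
    rw [perPoly, ← hA, hL, ← Finset.sum_coe_sort S]
    exact (Fintype.sum_equiv e _ _ fun i => rfl).symm

end Summit.ValiantsHypothesis.ValiantsHypothesis.Theorems.PolyaContinuedLaplaceRigidity.Laplace

end
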